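import Summits.CriticalPhenomena.Ising3DConformalLimit.Theses.FKParityRobustness
import Summits.CriticalPhenomena.Ising3DConformalLimit.Theorems.FKParityRobustnessDefs
import Summits.CriticalPhenomena.Ising3DConformalLimit.Theorems.FKParityRobustnessIndependentStrandsJoinCrossFatteningDefs
import Summits.CriticalPhenomena.Ising3DConformalLimit.Theorems.FKParityRobustnessIndependentStrandsJoinStubCrossFactorisation
import Summits.CriticalPhenomena.Ising3DConformalLimit.Theorems.FKParityRobustnessIndependentStrandsJoinStubCrossPairTreeReduction
import Summits.CriticalPhenomena.Ising3DConformalLimit.Theorems.FKParityRobustnessIndependentStrandsJoinStubTreeFloor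
import Summits.CriticalPhenomena.Ising3DConformalLimit.Theorems.FKParityRobustnessIndependentStrandsJoinStubBubble
import Summits.CriticalPhenomena.Ising3DConformalLimit.Theorems.IndependentStrandsJoin.Negative.GraphUniform
import Summits.CriticalPhenomena.Ising3DConformalLimit.Theorems.IndependentStrandsJoin.Negative.LoadBearing
import HarnessLib
import HarnessLib.Audit

/-!
# Skeleton — crux `IndependentStrandsJoin` (stmt-CriticalPhenomena-14625), line `cross-fattening-decoupling`

Route `FKParityRobustness`, sub-problem `Ising3DConformalLimit`; idea card
`Cruxes/IndependentStrandsJoin/Ideas/cross-fattening-decoupling.md` (crux-ideate r1, ideator 1; triage r1: pass/pass);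
line planner `planner-cruxplan-stmt-CriticalPhenomena-14625-cross-fattening-deco-0`, 2026-08-16.

THE LINE (the Aizenman–Duminil-Copin 2021 Lemma 4.4 second-moment template, with the two INDEPENDENT
double-current clusters replaced by the CROSSED, CONDITIONALLY INDEPENDENT clusters of the idea card).
For a `T`-join `F` of `{x, y}` write `K_x(F) = cl F x` (the edges of the `F`-component of `x`, the SOURCE
CLUSTER — tree convention of `Theorems/FKParityRobustnessDepletionBoundClusters.lean`) and `L_x(F) = F ∖ K_x(F)`
(its SOUP: an even subgraph of `G` off the vertices of `K_x(F)`; `F ↦ (K, L)` is the fibre bijection behind the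
route's `DepletionBound`).  For `F₁ ∈ 𝒯(a₀a₁)`, `F₂ ∈ 𝒯(a₂a₃)` CROSS the soups:

  `X₁ := {u : a₀ ↝_{K₁ ∪ L₂} u}`,  `X₂ := {u : a₂ ↝_{K₂ ∪ L₁} u}`,  `N := #(X₁ ∩ X₂ ∩ B_l)`

(`B_l` = the central window `{u ∈ Λ_N : 2|uᵢ| ≤ l}`).  Then (a) `N > 0 ⟹ a₀ ↔ a₂ in F₁ ∪ F₂` (the crux event;
`reachable_of_crossCount_pos`, PROVED here), (b) given `(K₁, K₂)` the soups are independent `ℓ^∅` configurations of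
the depleted graphs `G − V(K₁)`, `G − V(K₂)`, `X₁` is a function of `(K₁, L₂)` and `X₂` of `(K₂, L₁)`, so the two
crossed clusters are CONDITIONALLY INDEPENDENT (`stub_crossFactorisation`, an exact identity), and (c) Cauchy–Schwarz
(Paley–Zygmund, `crossMoment_sq_le`, PROVED here) gives

  `q := ℓ^{a₀a₁} ⊗ ℓ^{a₂a₃}[a₀ ↔ a₂ in F₁ ∪ F₂] ≥ P[N > 0] ≥ E[N]² / E[N²]`.

The six registered stubs bound `E[N]` from below and `E[N²]` from above against the DOUBLE-CURRENT window profile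
`Σ_{u ∈ B_l} π₁(u)π₂(u)`, `π₁(u) = ⟨σ_{a₀}σ_u⟩⟨σ_uσ_{a₁}⟩/⟨σ_{a₀}σ_{a₁}⟩` (everything in cleared-denominator
`Z`-form, `Z^{xy} = loopO1PartitionFunction`, `⟨σ_xσ_y⟩ = Z^{{x}∆{y}}/Z^∅`):

1. `stub_crossFactorisation` — graph-uniform EXACT identity (provable now, M): the first moment factorises through
   the source clusters, `Σ_{F₁,F₂} t^{|F₁|+|F₂|} N = Σ_{K₁,K₂} t^{|K₁|+|K₂|} Σ_{u∈B} A(a₀;K₁|K₂;u)·A(a₂;K₂|K₁;u)`,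
   `A(x;K|K';u) = Σ_{L ∈ 𝓔_∅(G − V(K'))} t^{|L|} 1[x ↝_{K ∪ L} u]` (depleted-soup attachment mass of the FIXED set `K`).
2. `stub_soupAttach` — d = 3, `β_c`, l-uniform, POINTWISE on the window (the card's DepletedAttach in the form the
   triage asked for: own soup discarded, other soup un-depleted): the strand cluster glued to an INDEPENDENT FULL
   critical soup attaches bulk points at the double-current rate, `P[u ∈ C(a₀; K₁ ∪ L')] ≥ c·π₁(u)`, `L' ~ ℓ^∅_G`.
3. `stub_holeCost` — d = 3, `β_c`, l-uniform (the decorrelation step the triage asked to be NAMED): crossing the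
   DEPLETED soups instead of independent full soups costs at most a constant factor in the mean window count,
   `E[N] ≥ c·E[N⁺]`, `N⁺ = #(X₁⁺ ∩ X₂⁺ ∩ B_l)`, `Xᵢ⁺ = C(aᵢ; Kᵢ ∪ L'ᵢ)` with independent full soups.
4. `stub_crossPairTree` — d = 3, `β_c`, l-uniform: the second moment is bounded by the PRODUCT of the two
   Aizenman–Duminil-Copin tree diagrams (ADC2021 Prop. A.3), `E[N²] ≤ C Σ_{v,w ∈ B} T₁(v,w)T₂(v,w)`,
   `T₁(v,w) = [τ(a₀v)τ(vw)τ(wa₁) + τ(a₀w)τ(wv)τ(va₁)]/τ(a₀a₁)`.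
5. `stub_treeFloor` — d = 3, two-point input, NECESSARY for the crux (Aizenman's tree-diagram bound
   `|U₄| ≤ 2·Tree` and the landed converse `crux ⇒ |U₄| ≥ 2c·G₀₁G₂₃`): `Σ_{u ∈ B_l} π₁(u)π₂(u) ≥ c` (the "η ≤ 1/2"
   side: the double-current window count has mean bounded below); doubles as the non-degeneracy of the profile.
6. `stub_bubble` — d = 3, two-point input (⟸ two-sided regularity `τ_{β_c}(x) ≍ |x|^{-1-η}`, `η ≤ 1/2`,
   ADC2021 Assumption 4.1; DCP2025 conditional `η ≤ 1/2`): `Σ_{v,w ∈ B} T₁T₂ ≤ C (Σ_{u∈B} π₁π₂)²`.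

`IndependentStrandsJoin_of` takes exactly the seven registered stubs (name-keyed `Registered.stub_*`; the six above plus
the bookkeeping stub 0 `stub_crossInclusion` = `posMass ≤ jointSum`, RESHAPE 1 of the line lead
prover-line-stmt-CriticalPhenomena-14625-1, 2026-08-16, through which the vocabulary file lands) and concludes the
crux BY NAME; the chain is `1 + 3 + 2 ⇒ E[N] ≥ c₃c₂²·profile`, `4 + 6 ⇒ E[N²] ≤ C₄C₆·profile²`, Cauchy–Schwarz and
the cross inclusion `⇒ q ≥ (c₃c₂²)²/(C₄C₆)`, with `5` discharging the degenerate case `profile = 0` (then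
`Z₀₁Z₂₃ = 0` and the crux inequality is `0 ≤ jointSum`).  No stub restates the crux: 1 is an identity, 2/3/4 are
one- and two-point statements about crossed clusters one inclusion INSIDE the crux system, 5/6 are statements about the
critical two-point function alone.  Disproof.lean (cdisprove cycle 1) honoured: § A′ (no graph-uniform constant) —
only stub 1 is graph-uniform and it is an identity; the box `Λ_N ⊂ ℤ³` at `β_c` enters through 2–6; § A (content =
l-uniformity of ONE constant) — every box stub has the `∃ c, ∀ l ≥ 1, ∃ N₀, ∀ N ≥ N₀` shape of the crux; § D regime
scan — 5/6 fail for `d ≥ 4` (`η = 0`: window mean `O(1)` but bubble `log l`, ADC2021 § 4) and for `t < t_c`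
(exponential decay), as they must.  Landed negatives imported and re-checked against: `Negative/GraphUniform`
(`not_graphUniformStrandsJoin`), `Negative/LoadBearing` (`jointSum_le_mul`: `c ≤ 1`).

Auxiliary DEFINITIONS (this file, namespace `…CrossFatteningDecoupling`; to be landed verbatim as a `Theorems/…Defs.lean`
before the stubs land as `--supports stmt-CriticalPhenomena-14625` files): `rch`, `cl`, `soup`, `offCl`,
`srcClusters`, `crossCount`, `attachOff`, `attachFull`, `zOff`, `zPair`, `profile`, `treePair`, `bubbleSum`,
`crossMoment`, `crossMomentSq`, `crossMomentK`, `fullMass`, `posMass`, `jointSum`, `window`.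
-/

noncomputable section

open Finset SimpleGraph
open Literature.Probability.LatticeModels
open Summit.CriticalPhenomena.Ising3DConformalLimit.Cruxes.ParityRobustMerging.PlaquetteXorSurgery
  (tetra tetra_injective tanh_criticalBeta_nonneg)
open Summit.CriticalPhenomena.Ising3DConformalLimit.Theses.FKParityRobustness (IndependentStrandsJoin)

namespace Summit.CriticalPhenomena.Ising3DConformalLimit.Cruxes.IndependentStrandsJoin.CrossFatteningDecoupling

open scoped Classical BigOperators symmDiff

/-! ## Vocabulary

RESHAPE 2 (lead -1, 2026-08-16): the vocabulary (`rch cl offCl soup crossCount srcClusters attachOff attachFull zOff zPair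
profile treePair bubbleSum crossMoment crossMomentSq crossMomentK fullMass posMass jointSum window` and the small API
`cl_subset soup_subset reachable_of_crossCount_pos zPair_nonneg profile_nonneg posMass_nonneg posMass_le_jointSum`) now comes
from the LANDED vocabulary file `Theorems/FKParityRobustnessIndependentStrandsJoinCrossFatteningDefs.lean` (p95928, same
namespace, with the registered bookkeeping stub `stub_crossInclusion`), and `stub_crossFactorisation` from the LANDED
`Theorems/FKParityRobustnessIndependentStrandsJoinStubCrossFactorisation.lean` (p98192). -/

/-! ## General lemmas (proved): cross inclusion, nonnegativity, Cauchy–Schwarz -/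

section General

variable {V : Type*} [Fintype V] [DecidableEq V] (G : SimpleGraph V) [DecidableRel G.Adj]

/-- **Cauchy–Schwarz / Paley–Zygmund with cleared denominators**:
`(Σ w N)² ≤ (Σ w 1[N > 0]) · (Σ w N²)` over the configuration pairs, `w = t^{|F₁|+|F₂|} ≥ 0`. -/
theorem crossMoment_sq_le {t : ℝ} (ht : 0 ≤ t) (x₁ y₁ x₂ y₂ : V) (B : Finset V) :
    crossMoment G t x₁ y₁ x₂ y₂ B ^ 2 ≤ posMass G t x₁ y₁ x₂ y₂ B * crossMomentSq G t x₁ y₁ x₂ y₂ B := by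
  unfold crossMoment posMass crossMomentSq
  rw [← Finset.sum_product', ← Finset.sum_product', ← Finset.sum_product']
  refine Finset.sum_sq_le_sum_mul_sum_of_sq_le_mul _ (fun p _ => ?_) (fun p _ => ?_) (fun p _ => ?_)
  · split_ifs
    · positivity
    · exact le_rfl
  · positivity
  · by_cases h : 0 < crossCount x₁ x₂ B p.1 p.2
    · rw [if_pos h]; exact le_of_eq (by ring)
    · have h0 : crossCount x₁ x₂ B p.1 p.2 = 0 := Nat.eq_zero_of_not_pos h
      rw [if_neg h, h0]; simp

/-- **The real-arithmetic core of the second-moment method** (with the degenerate profile handled by the tree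
floor): from `c₁·P ≤ Z₀²·A` (first moment), `A² ≤ Bq·D` (Cauchy–Schwarz), `Z₀⁴·D ≤ C₄·T` (pair tree bound),
`Z₀₁Z₂₃·T ≤ C₆·P²` (bubble), `c₅·Z₀²Z₀₁Z₂₃ ≤ P` (tree floor) and `Bq ≤ J` conclude `(c₁²/(C₄C₆))·Z₀₁·Z₂₃ ≤ J`. -/
theorem secondMoment_algebra {Z0 Z01 Z23 A D Bq J P T c₁ C₄ c₅ C₆ : ℝ} (hZ0 : 0 < Z0) (hZ01 : 0 ≤ Z01)
    (hZ23 : 0 ≤ Z23) (hBq : 0 ≤ Bq) (hP : 0 ≤ P) (hc₁ : 0 < c₁) (hC₄ : 0 < C₄) (hc₅ : 0 < c₅) (hC₆ : 0 < C₆)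
    (hFM : c₁ * P ≤ Z0 ^ 2 * A) (hCS : A ^ 2 ≤ Bq * D) (hSM : Z0 ^ 4 * D ≤ C₄ * T)
    (hB : Z01 * Z23 * T ≤ C₆ * P ^ 2) (hF : c₅ * (Z0 ^ 2 * Z01 * Z23) ≤ P) (hJ : Bq ≤ J) :
    c₁ ^ 2 / (C₄ * C₆) * Z01 * Z23 ≤ J := by
  rcases hP.eq_or_lt with hP0 | hPpos
  · -- degenerate profile: the tree floor forces `Z₀₁Z₂₃ = 0`
    subst hP0
    have h2 : 0 ≤ Z0 ^ 2 * Z01 * Z23 := by positivity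
    have hX : Z0 ^ 2 * Z01 * Z23 ≤ 0 :=
      le_of_mul_le_mul_left (by rw [mul_zero]; exact hF) hc₅
    have h3 : Z0 ^ 2 * Z01 * Z23 = 0 := le_antisymm hX h2
    have h4 : Z01 * Z23 = 0 := by
      have hZ0' : Z0 ^ 2 ≠ 0 := by positivity
      have : Z0 ^ 2 * (Z01 * Z23) = 0 := by rw [← h3]; ring
      rcases mul_eq_zero.1 this with h | h
      · exact absurd h hZ0'
      · exact h
    calc c₁ ^ 2 / (C₄ * C₆) * Z01 * Z23 = c₁ ^ 2 / (C₄ * C₆) * (Z01 * Z23) := by ring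
      _ = 0 := by rw [h4, mul_zero]
      _ ≤ J := hBq.trans hJ
  · -- generic case
    have h0 : 0 ≤ c₁ * P := by positivity
    have h1 : (c₁ * P) ^ 2 ≤ (Z0 ^ 2 * A) ^ 2 := pow_le_pow_left₀ h0 hFM 2
    have h2 : (Z0 ^ 2 * A) ^ 2 ≤ Bq * (C₄ * T) := by
      calc (Z0 ^ 2 * A) ^ 2 = Z0 ^ 4 * A ^ 2 := by ring
        _ ≤ Z0 ^ 4 * (Bq * D) := by gcongr
        _ = Bq * (Z0 ^ 4 * D) := by ring
        _ ≤ Bq * (C₄ * T) := by gcongr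
    have h3 : (c₁ * P) ^ 2 * (Z01 * Z23) ≤ Bq * C₄ * (C₆ * P ^ 2) := by
      calc (c₁ * P) ^ 2 * (Z01 * Z23) ≤ Bq * (C₄ * T) * (Z01 * Z23) := by
            have hZZ : 0 ≤ Z01 * Z23 := by positivity
            exact mul_le_mul_of_nonneg_right (h1.trans h2) hZZ
        _ = Bq * C₄ * (Z01 * Z23 * T) := by ring
        _ ≤ Bq * C₄ * (C₆ * P ^ 2) := by
            have : 0 ≤ Bq * C₄ := by positivity
            exact mul_le_mul_of_nonneg_left hB this
    have hP2 : 0 < P ^ 2 := by positivity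
    have h4 : c₁ ^ 2 * (Z01 * Z23) ≤ Bq * C₄ * C₆ := by
      have : c₁ ^ 2 * (Z01 * Z23) * P ^ 2 ≤ Bq * C₄ * C₆ * P ^ 2 :=
        calc c₁ ^ 2 * (Z01 * Z23) * P ^ 2 = (c₁ * P) ^ 2 * (Z01 * Z23) := by ring
          _ ≤ Bq * C₄ * (C₆ * P ^ 2) := h3
          _ = Bq * C₄ * C₆ * P ^ 2 := by ring
      exact le_of_mul_le_mul_right this hP2
    have hCC : 0 < C₄ * C₆ := by positivity
    calc c₁ ^ 2 / (C₄ * C₆) * Z01 * Z23 = c₁ ^ 2 * (Z01 * Z23) / (C₄ * C₆) := by ring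
      _ ≤ Bq * C₄ * C₆ / (C₄ * C₆) := div_le_div_of_nonneg_right h4 hCC.le
      _ = Bq := by rw [mul_assoc, mul_div_assoc, div_self hCC.ne', mul_one]
      _ ≤ J := hJ

end General

/-! ## The stub STATEMENTS as named `Prop`s (the composition is stated over their name-keyed aliases) -/

/-- Statement of Stub 0 (`stub_crossInclusion`, the bookkeeping stub through which the line's vocabulary file
lands): `posMass ≤ jointSum` on every finite graph for `t ≥ 0` — the CROSS INCLUSION `N_B > 0 ⇒ a₀ ↔ a₂ in F₁ ∪ F₂`
summed against the weights `t^{|F₁|+|F₂|}`. -/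
def CrossInclusion : Prop :=
  ∀ (V : Type) [Fintype V] [DecidableEq V] (G : SimpleGraph V) [DecidableRel G.Adj] (t : ℝ),
    0 ≤ t → ∀ (a : Fin 4 → V) (B : Finset V),
    posMass G t (a 0) (a 1) (a 2) (a 3) B ≤ jointSum G t a

/-- Statement of Stub 1 (`stub_crossFactorisation`): the conditional-independence factorisation of the first
crossed moment — an exact identity on every finite graph, for every real `t`. -/
def CrossFactorisation : Prop :=
  ∀ (V : Type) [Fintype V] [DecidableEq V] (G : SimpleGraph V) [DecidableRel G.Adj] (t : ℝ)
    (x₁ y₁ x₂ y₂ : V) (B : Finset V),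
    crossMoment G t x₁ y₁ x₂ y₂ B = crossMomentK G t x₁ y₁ x₂ y₂ B

/-- Statement of Stub 2 (`stub_soupAttach`): the un-depleted one-point floor on the window, both copies. -/
def SoupAttach : Prop :=
  ∃ c : ℝ, 0 < c ∧ ∀ l : ℕ, 1 ≤ l → ∃ N₀ : ℕ, ∀ N : ℕ, N₀ ≤ N → ∀ a : Fin 4 → ↥(box 3 N),
    (∀ i, ((a i : Site 3)) = (l : ℤ) • tetra i) →
    (let G := ((zdGraph 3).comap (Subtype.val : ↥(box 3 N) → Site 3));
     let t : ℝ := Real.tanh (criticalBeta 3);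
     ∀ u ∈ window N l,
       c * (zPair G t (a 0) u * zPair G t u (a 1)) ≤ fullMass G t (a 0) (a 1) u ∧
       c * (zPair G t (a 2) u * zPair G t u (a 3)) ≤ fullMass G t (a 2) (a 3) u)

/-- Statement of Stub 3 (`stub_holeCost`): depleting the crossed soups costs at most a constant in the mean. -/
def HoleCost : Prop :=
  ∃ c : ℝ, 0 < c ∧ ∀ l : ℕ, 1 ≤ l → ∃ N₀ : ℕ, ∀ N : ℕ, N₀ ≤ N → ∀ a : Fin 4 → ↥(box 3 N),
    (∀ i, ((a i : Site 3)) = (l : ℤ) • tetra i) →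
    (let G := ((zdGraph 3).comap (Subtype.val : ↥(box 3 N) → Site 3));
     let t : ℝ := Real.tanh (criticalBeta 3);
     c * ∑ u ∈ window N l, fullMass G t (a 0) (a 1) u * fullMass G t (a 2) (a 3) u
       ≤ loopO1PartitionFunction G t ∅ ^ 2 * crossMomentK G t (a 0) (a 1) (a 2) (a 3) (window N l))

/-- Statement of Stub 4 (`stub_crossPairTree`): second crossed moment ≤ product of the two ADC trees. -/
def CrossPairTree : Prop :=
  ∃ C : ℝ, 0 < C ∧ ∀ l : ℕ, 1 ≤ l → ∃ N₀ : ℕ, ∀ N : ℕ, N₀ ≤ N → ∀ a : Fin 4 → ↥(box 3 N),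
    (∀ i, ((a i : Site 3)) = (l : ℤ) • tetra i) →
    (let G := ((zdGraph 3).comap (Subtype.val : ↥(box 3 N) → Site 3));
     let t : ℝ := Real.tanh (criticalBeta 3);
     loopO1PartitionFunction G t ∅ ^ 4 * crossMomentSq G t (a 0) (a 1) (a 2) (a 3) (window N l)
       ≤ C * bubbleSum G t a (window N l))

/-- Statement of Stub 5 (`stub_treeFloor`): the double-current window mean is bounded below (necessary for the crux). -/
def TreeFloor : Prop :=
  ∃ c : ℝ, 0 < c ∧ ∀ l : ℕ, 1 ≤ l → ∃ N₀ : ℕ, ∀ N : ℕ, N₀ ≤ N → ∀ a : Fin 4 → ↥(box 3 N),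
    (∀ i, ((a i : Site 3)) = (l : ℤ) • tetra i) →
    (let G := ((zdGraph 3).comap (Subtype.val : ↥(box 3 N) → Site 3));
     let t : ℝ := Real.tanh (criticalBeta 3);
     c * (loopO1PartitionFunction G t ∅ ^ 2 * loopO1PartitionFunction G t {a 0, a 1} *
         loopO1PartitionFunction G t {a 2, a 3}) ≤ profile G t a (window N l))

/-- Statement of Stub 6 (`stub_bubble`): the window bubble is dominated by the squared window mean. -/
def Bubble : Prop :=
  ∃ C : ℝ, 0 < C ∧ ∀ l : ℕ, 1 ≤ l → ∃ N₀ : ℕ, ∀ N : ℕ, N₀ ≤ N → ∀ a : Fin 4 → ↥(box 3 N),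
    (∀ i, ((a i : Site 3)) = (l : ℤ) • tetra i) →
    (let G := ((zdGraph 3).comap (Subtype.val : ↥(box 3 N) → Site 3));
     let t : ℝ := Real.tanh (criticalBeta 3);
     loopO1PartitionFunction G t {a 0, a 1} * loopO1PartitionFunction G t {a 2, a 3} * bubbleSum G t a (window N l)
       ≤ C * profile G t a (window N l) ^ 2)

/-- **PAIR HOLE FILLING** (step (ii) of `stub_crossPairTree`; the hypothesis of the LANDED reduction
`Theorems.stub_crossPairTreeReduction`, lead c1-0's wave, verbatim): in the boxes, the crossed DEPLETED pair connections summed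
over the window are dominated, uniformly in `l`, by the product of the two UN-depleted `ℓ^{xy} ⊗ ℓ^∅` pair connections — the
one place where conditioning a critical loop soup on avoiding the other strand's cluster must be paid for (d = 3, open). -/
def PairHoleFilling : Prop :=
  ∃ C : ℝ, 0 < C ∧ ∀ l : ℕ, 1 ≤ l → ∃ N₀ : ℕ, ∀ N : ℕ, N₀ ≤ N → ∀ a : Fin 4 → ↥(box 3 N),
      (∀ i, ((a i : Site 3)) = (l : ℤ) • tetra i) →
       loopO1PartitionFunction ((zdGraph 3).comap (Subtype.val : ↥(box 3 N) → Site 3)) (Real.tanh (criticalBeta 3)) ∅ ^ 2 *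
           ∑ v ∈ window N l, ∑ w ∈ window N l,
             ∑ K₁ ∈ srcClusters ((zdGraph 3).comap (Subtype.val : ↥(box 3 N) → Site 3)) (a 0) {a 0, a 1},
               ∑ K₂ ∈ srcClusters ((zdGraph 3).comap (Subtype.val : ↥(box 3 N) → Site 3)) (a 2) {a 2, a 3},
               (Real.tanh (criticalBeta 3)) ^ (#K₁ + #K₂) *
               ((∑ L ∈ tJoins ((zdGraph 3).comap (Subtype.val : ↥(box 3 N) → Site 3)) (offCl K₂ (a 2)) ∅,
                   if rch (K₁ ∪ L) (a 0) v ∧ rch (K₁ ∪ L) (a 0) w then (Real.tanh (criticalBeta 3)) ^ #L else 0) *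
                (∑ L ∈ tJoins ((zdGraph 3).comap (Subtype.val : ↥(box 3 N) → Site 3)) (offCl K₁ (a 0)) ∅,
                   if rch (K₂ ∪ L) (a 2) v ∧ rch (K₂ ∪ L) (a 2) w then (Real.tanh (criticalBeta 3)) ^ #L else 0))
         ≤ C * ∑ v ∈ window N l, ∑ w ∈ window N l,
             (∑ F ∈ tJoins ((zdGraph 3).comap (Subtype.val : ↥(box 3 N) → Site 3)) Set.univ {a 0, a 1}, ∑ L ∈ tJoins ((zdGraph 3).comap (Subtype.val : ↥(box 3 N) → Site 3)) Set.univ ∅,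
                 if rch (F ∪ L) (a 0) v ∧ rch (F ∪ L) (a 0) w then (Real.tanh (criticalBeta 3)) ^ (#F + #L) else 0) *
             (∑ F ∈ tJoins ((zdGraph 3).comap (Subtype.val : ↥(box 3 N) → Site 3)) Set.univ {a 2, a 3}, ∑ L ∈ tJoins ((zdGraph 3).comap (Subtype.val : ↥(box 3 N) → Site 3)) Set.univ ∅,
                 if rch (F ∪ L) (a 2) v ∧ rch (F ∪ L) (a 2) w then (Real.tanh (criticalBeta 3)) ^ (#F + #L) else 0)

/-- **TWO-POINT `η`-REGULARITY with `η < 1/2`** — the named OPEN two-point input behind Stubs 5–6 (Aizenman–Duminil-Copin 2021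
Assumption 4.1 in `d = 3`; numerically `η = 0.036`): the Literature predicate `HasIsingEtaBounds 3 η` (two-sided bounds
`c‖x‖^{-(1+η)} ≤ ⟨σ₀σ_x⟩_{β_c} ≤ C‖x‖^{-(1+η)}`) for some `0 ≤ η < 1/2`.  The LANDED conditional reductions of lead c1-0's wave
(`Theorems.stub_treeFloor_of_etaBounds`, `Theorems.stub_bubble_of_etaBounds`) turn it into `TreeFloor ∧ Bubble`. -/
def EtaBounds : Prop :=
  ∃ η : ℝ, HasIsingEtaBounds 3 η ∧ 0 ≤ η ∧ η < 1 / 2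

/-- The crux's statement, verbatim (the body of the route decl `IndependentStrandsJoin`; definitionally equal to it —
used as the conclusion of the auxiliary seven-hypothesis composition so that exactly ONE theorem of this file concludes
the crux by name). -/
def CruxBody : Prop :=
  let tetra : Fin 4 → Literature.Probability.LatticeModels.Site 3 := ![![-1, -1, -1], ![1, 1, -1], ![1, -1, 1], ![-1, 1, 1]]; ∃ c : ℝ, 0 < c ∧ ∀ l : ℕ, 1 ≤ l → ∃ N₀ : ℕ, ∀ N : ℕ, N₀ ≤ N → ∀ a : Fin 4 → ↥(Literature.Probability.LatticeModels.box 3 N), (∀ i, ((a i : Literature.Probability.LatticeModels.Site 3)) = (l : ℤ) • tetra i) → (let G := ((Literature.Probability.LatticeModels.zdGraph 3).comap (Subtype.val : ↥(Literature.Probability.LatticeModels.box 3 N) → Literature.Probability.LatticeModels.Site 3)); let t : ℝ := Real.tanh (Literature.Probability.LatticeModels.criticalBeta 3); c * Literature.Probability.LatticeModels.loopO1PartitionFunction G t {a 0, a 1} * Literature.Probability.LatticeModels.loopO1PartitionFunction G t {a 2, a 3} ≤ ∑ F₁ ∈ Literature.Probability.LatticeModels.tJoins G Set.univ {a 0, a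 1}, ∑ F₂ ∈ Literature.Probability.LatticeModels.tJoins G Set.univ {a 2, a 3}, if (SimpleGraph.fromEdgeSet ((↑F₁ : Set (Sym2 ↥(Literature.Probability.LatticeModels.box 3 N))) ∪ ↑F₂)).Reachable (a 0) (a 2) then t ^ (F₁.card + F₂.card) else 0)

example : CruxBody ↔ IndependentStrandsJoin := Iff.rfl

/-! ### Name-keyed aliases of the registered stubs (the hypotheses of the composition) -/
namespace Registered

/-- Alias of `CrossInclusion` keyed by the registered stub name. -/
abbrev stub_crossInclusion : Prop := CrossInclusion
/-- Alias of `CrossFactorisation` keyed by the registered stub name. -/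
abbrev stub_crossFactorisation : Prop := CrossFactorisation
/-- Alias of `SoupAttach` keyed by the registered stub name. -/
abbrev stub_soupAttach : Prop := SoupAttach
/-- Alias of `HoleCost` keyed by the registered stub name. -/
abbrev stub_holeCost : Prop := HoleCost
/-- Alias of `CrossPairTree` keyed by the registered stub name. -/
abbrev stub_crossPairTree : Prop := CrossPairTree
/-- Alias of `TreeFloor` keyed by the registered stub name. -/
abbrev stub_treeFloor : Prop := TreeFloor
/-- Alias of `Bubble` keyed by the registered stub name. -/
abbrev stub_bubble : Prop := Bubble
/-- Alias of `PairHoleFilling` keyed by the registered stub name. -/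
abbrev stub_pairHoleFilling : Prop := PairHoleFilling
/-- Alias of `EtaBounds` keyed by the registered stub name. -/
abbrev stub_etaBounds : Prop := EtaBounds

end Registered

/-! ## The composition: the six registered stubs imply the crux, BY NAME (no `sorry` below this line except in
the `stub_*` theorems of the last section) -/

/-- **The seven-hypothesis composition (RESHAPE 1–2; conclusion `CruxBody` ≡ the crux).**  Second-moment method on the crossed window count:
`E[N] ≥ c₃c₂²·profile` (stubs 1, 3, 2), `E[N²] ≤ C₄C₆·profile²` (stubs 4, 6), Cauchy–Schwarz and the cross
inclusion give `jointSum ≥ posMass ≥ ((c₃c₂²)²/(C₄C₆))·Z₀₁Z₂₃`; stub 5 discharges `profile = 0`. -/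
theorem IndependentStrandsJoin_of_seven (h0 : Registered.stub_crossInclusion) (h1 : Registered.stub_crossFactorisation)
    (h2 : Registered.stub_soupAttach) (h3 : Registered.stub_holeCost) (h4 : Registered.stub_crossPairTree)
    (h5 : Registered.stub_treeFloor) (h6 : Registered.stub_bubble) : CruxBody := by
  show IndependentStrandsJoin
  obtain ⟨c₂, hc₂, h2⟩ := h2
  obtain ⟨c₃, hc₃, h3⟩ := h3
  obtain ⟨C₄, hC₄, h4⟩ := h4
  obtain ⟨c₅, hc₅, h5⟩ := h5
  obtain ⟨C₆, hC₆, h6⟩ := h6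
  refine ⟨(c₃ * c₂ ^ 2) ^ 2 / (C₄ * C₆), by positivity, fun l hl => ?_⟩
  obtain ⟨N₂, h2⟩ := h2 l hl
  obtain ⟨N₃, h3⟩ := h3 l hl
  obtain ⟨N₄, h4⟩ := h4 l hl
  obtain ⟨N₅, h5⟩ := h5 l hl
  obtain ⟨N₆, h6⟩ := h6 l hl
  refine ⟨N₂ + N₃ + N₄ + N₅ + N₆, fun N hN a ha => ?_⟩
  have ha' : ∀ i, ((a i : Site 3)) = (l : ℤ) • tetra i := fun i => by rw [ha i]; rfl
  have i2 := h2 N (by omega) a ha'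
  have i3 := h3 N (by omega) a ha'
  have i4 := h4 N (by omega) a ha'
  have i5 := h5 N (by omega) a ha'
  have i6 := h6 N (by omega) a ha'
  dsimp only at i2 i3 i4 i5 i6 ⊢
  set G : SimpleGraph ↥(box 3 N) := (zdGraph 3).comap (Subtype.val : ↥(box 3 N) → Site 3) with hG
  set t : ℝ := Real.tanh (criticalBeta 3) with htdef
  set B : Finset ↥(box 3 N) := window N l with hB
  have ht : 0 ≤ t := tanh_criticalBeta_nonneg
  have hZ0 : 0 < loopO1PartitionFunction G t ∅ := loopO1PartitionFunction_empty_pos G ht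
  have hZ01 : 0 ≤ loopO1PartitionFunction G t {a 0, a 1} := loopO1PartitionFunction_nonneg G ht _
  have hZ23 : 0 ≤ loopO1PartitionFunction G t {a 2, a 3} := loopO1PartitionFunction_nonneg G ht _
  -- first moment: stubs 1 + 3 + 2
  have hFM : (c₃ * c₂ ^ 2) * profile G t a B ≤
      loopO1PartitionFunction G t ∅ ^ 2 * crossMoment G t (a 0) (a 1) (a 2) (a 3) B := by
    rw [h1 (↥(box 3 N)) G t (a 0) (a 1) (a 2) (a 3) B]
    have hsum : c₂ ^ 2 * profile G t a B ≤ ∑ u ∈ B, fullMass G t (a 0) (a 1) u * fullMass G t (a 2) (a 3) u := by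
      unfold profile
      rw [Finset.mul_sum]
      refine Finset.sum_le_sum fun u hu => ?_
      obtain ⟨hu₁, hu₂⟩ := i2 u hu
      have hp₁ : 0 ≤ c₂ * (zPair G t (a 0) u * zPair G t u (a 1)) :=
        mul_nonneg hc₂.le (mul_nonneg (zPair_nonneg G ht _ _) (zPair_nonneg G ht _ _))
      have hp₂ : 0 ≤ c₂ * (zPair G t (a 2) u * zPair G t u (a 3)) :=
        mul_nonneg hc₂.le (mul_nonneg (zPair_nonneg G ht _ _) (zPair_nonneg G ht _ _))
      calc c₂ ^ 2 * (zPair G t (a 0) u * zPair G t u (a 1) * (zPair G t (a 2) u * zPair G t u (a 3)))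
          = (c₂ * (zPair G t (a 0) u * zPair G t u (a 1))) * (c₂ * (zPair G t (a 2) u * zPair G t u (a 3))) := by
            ring
        _ ≤ fullMass G t (a 0) (a 1) u * fullMass G t (a 2) (a 3) u :=
            mul_le_mul hu₁ hu₂ hp₂ (hp₁.trans hu₁)
    calc c₃ * c₂ ^ 2 * profile G t a B = c₃ * (c₂ ^ 2 * profile G t a B) := by ring
      _ ≤ c₃ * ∑ u ∈ B, fullMass G t (a 0) (a 1) u * fullMass G t (a 2) (a 3) u :=
          mul_le_mul_of_nonneg_left hsum hc₃.le
      _ ≤ loopO1PartitionFunction G t ∅ ^ 2 * crossMomentK G t (a 0) (a 1) (a 2) (a 3) B := i3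
  -- Cauchy–Schwarz and the cross inclusion
  have hCS := crossMoment_sq_le G ht (a 0) (a 1) (a 2) (a 3) B
  have hJ := h0 (↥(box 3 N)) G t ht a B
  have hBq := posMass_nonneg G ht (a 0) (a 1) (a 2) (a 3) B
  -- the algebra (stub 5 handles the degenerate profile)
  have key := secondMoment_algebra hZ0 hZ01 hZ23 hBq (profile_nonneg G ht a B) (by positivity) hC₄ hc₅ hC₆
    hFM hCS i4 i6 i5 hJ
  -- `jointSum` (vocabulary file) and the crux's right-hand side agree up to the `Decidable` instances of the
  -- indicator, bridged by `if_congr` (RESHAPE 2: the literal `simpa only [jointSum]` no longer unifies)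
  refine key.trans (le_of_eq ?_)
  unfold jointSum
  exact Finset.sum_congr rfl fun F₁ _ => Finset.sum_congr rfl fun F₂ _ => by congr 1

/-- **RESHAPE 3 (lead -1, 2026-08-16T14:00Z) — the line closes the crux modulo its FOUR open stubs.**  The two-point
stubs 5–6 and steps (ii)+(iii) of stub 4 are replaced by their LANDED reductions (lead c1-0's wave: `stub_treeFloor_of_etaBounds`,
`stub_bubble_of_etaBounds`, `stub_crossPairTreeReduction` over the Aizenman–Duminil-Copin tree bound `stub_crossPairTreeBound`),
and the two identities `stub_crossInclusion`, `stub_crossFactorisation` are the LANDED theorems (used inside, not assumed), so the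
hypotheses are exactly the four OPEN stubs: the two one-soup cluster floors `stub_soupAttach`, `stub_holeCost`, PAIR HOLE FILLING
`stub_pairHoleFilling`, and the named two-point input `stub_etaBounds` (`HasIsingEtaBounds 3 η`, `η < 1/2`). -/
theorem IndependentStrandsJoin_of
    (h2 : Registered.stub_soupAttach) (h3 : Registered.stub_holeCost) (h4 : Registered.stub_pairHoleFilling)
    (h7 : Registered.stub_etaBounds) : IndependentStrandsJoin := by
  -- the two LANDED identities (no longer hypotheses: p95928, p98192)
  have h0 : Registered.stub_crossInclusion :=
    Summit.CriticalPhenomena.Ising3DConformalLimit.Theorems.stub_crossInclusion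
  have h1 : Registered.stub_crossFactorisation :=
    Summit.CriticalPhenomena.Ising3DConformalLimit.Theorems.stub_crossFactorisation
  obtain ⟨η, hη, hη0, hη2⟩ := h7
  have h5 : Registered.stub_treeFloor :=
    Summit.CriticalPhenomena.Ising3DConformalLimit.Theorems.stub_treeFloor_of_etaBounds η hη hη2.le
  have h6 : Registered.stub_bubble :=
    Summit.CriticalPhenomena.Ising3DConformalLimit.Theorems.stub_bubble_of_etaBounds hη hη0 hη2
  have h4' : Registered.stub_crossPairTree :=
    Summit.CriticalPhenomena.Ising3DConformalLimit.Theorems.stub_crossPairTreeReduction h4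
  exact IndependentStrandsJoin_of_seven h0 h1 h2 h3 h4' h5 h6

/-! ## The registered stubs (`sorry` lives ONLY here); statements = the named `Prop`s above, verbatim -/

/-- **Stub 0 (`stub_crossInclusion`, graph-uniform bookkeeping; LANDED p95928) — it is
`posMass_le_jointSum` above, and lands together with the line's vocabulary file
`Theorems/FKParityRobustnessIndependentStrandsJoinCrossFatteningDefs.lean`).**  For `t ≥ 0`:
`posMass G t (a 0) (a 1) (a 2) (a 3) B ≤ jointSum G t a` (cross inclusion, termwise). -/
theorem stub_crossInclusion :
    ∀ (V : Type) [Fintype V] [DecidableEq V] (G : SimpleGraph V) [DecidableRel G.Adj] (t : ℝ),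
      0 ≤ t → ∀ (a : Fin 4 → V) (B : Finset V),
      posMass G t (a 0) (a 1) (a 2) (a 3) B ≤ jointSum G t a :=
  Summit.CriticalPhenomena.Ising3DConformalLimit.Theorems.stub_crossInclusion

/-- **Stub 1 (`stub_crossFactorisation`, graph-uniform exact identity; LANDED p98192).**  For every finite
graph, every real `t`, sources `{x₁,y₁}`, `{x₂,y₂}` and window `B`:
`Σ_{F₁ ∈ 𝒯(x₁y₁)} Σ_{F₂ ∈ 𝒯(x₂y₂)} t^{|F₁|+|F₂|}·N_B(F₁,F₂)
   = Σ_{K₁ ∈ 𝒦(x₁;x₁y₁)} Σ_{K₂ ∈ 𝒦(x₂;x₂y₂)} t^{|K₁|+|K₂|} Σ_{u ∈ B} A(x₁;K₁|K₂;u)·A(x₂;K₂|K₁;u)`.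
Proof: `F ↦ (K_x(F), F ∖ K_x(F))` is a bijection from `𝒯(xy)` onto `{(K, L) : K ∈ 𝒦(x;xy), L ∈ 𝓔_∅(offCl K x)}`
with `|F| = |K| + |L|` (the tree's `fibre_sum`, `Theorems/FKParityRobustnessDepletionBoundClusters.lean` /
`…IndependentStrandsJoinStubDepletionBound.lean`), applied to both sums; then `cl F₁ x₁ = K₁`, `soup F₂ x₂ = L₂`, so
the indicator of `u ∈ X₁` depends on `(K₁, L₂)` only and that of `u ∈ X₂` on `(K₂, L₁)` only, and the quadruple sum
factorises (Fubini).  This is the card's conditional independence `X₁ ⊥ X₂ | (K₁, K₂)`, as an identity of sums. -/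
theorem stub_crossFactorisation :
    ∀ (V : Type) [Fintype V] [DecidableEq V] (G : SimpleGraph V) [DecidableRel G.Adj] (t : ℝ)
      (x₁ y₁ x₂ y₂ : V) (B : Finset V),
      crossMoment G t x₁ y₁ x₂ y₂ B = crossMomentK G t x₁ y₁ x₂ y₂ B :=
  Summit.CriticalPhenomena.Ising3DConformalLimit.Theorems.stub_crossFactorisation

/-- **Stub 2 (`stub_soupAttach`, d = 3, `β_c`, l-uniform, pointwise on the window; open, size L; co-hardest).**
For `a = l·tetra ⊂ Λ_N`, `u ∈ B_l` and BOTH copies: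
`c · Z(a₀u)Z(ua₁) ≤ Σ_{K ∈ 𝒦(a₀;a₀a₁)} t^{|K|} Z^∅(G − V(K)) A⁺(a₀;K;u)`, i.e. (dividing by `Z₀₁Z^∅`)
`P_{ℓ^{a₀a₁} ⊗ ℓ^∅}[u ∈ C(a₀; K_{a₀}(F₁) ∪ L')] ≥ c · ⟨σ_{a₀}σ_u⟩⟨σ_uσ_{a₁}⟩/⟨σ_{a₀}σ_{a₁}⟩`: the strand cluster
glued to an INDEPENDENT FULL critical soup `L'` (own soup `L₁` discarded, as the crossing requires) attaches bulk
points at the double-current rate.  Upper bound of the same order holds by switching (`C(a₀;K₁∪L') ⊆ 𝐂_{n₁+n₃}(a₀)`,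
one-point function `= ττ/τ`).  Why plausible: the union cluster `C⁺ = C(a₀; F₁ ∪ L')` has this profile in MC
(`A ≈ 0.75` flat, `E|V(C⁺)| ∝ l^{1.89}`, j014058) and the XOR identity `OnePointSwitch` makes `{a₀ ~_{F₁∆L'} u}`
exact; the bet is that stepping stones through the own soup `L₁` are not load-bearing (triage r1-2 (1)).  Why it
might fail: a tip/stepping-stone cascade making the attachment constant decay like `l^{-κ}` (triage r1-1 on
`LocalAttach`), here for the K-glued rather than F-glued cluster. -/
theorem stub_soupAttach :
    ∃ c : ℝ, 0 < c ∧ ∀ l : ℕ, 1 ≤ l → ∃ N₀ : ℕ, ∀ N : ℕ, N₀ ≤ N → ∀ a : Fin 4 → ↥(box 3 N),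
      (∀ i, ((a i : Site 3)) = (l : ℤ) • tetra i) →
      (let G := ((zdGraph 3).comap (Subtype.val : ↥(box 3 N) → Site 3));
       let t : ℝ := Real.tanh (criticalBeta 3);
       ∀ u ∈ window N l,
         c * (zPair G t (a 0) u * zPair G t u (a 1)) ≤ fullMass G t (a 0) (a 1) u ∧
         c * (zPair G t (a 2) u * zPair G t u (a 3)) ≤ fullMass G t (a 2) (a 3) u) := by
  sorry

/-- **Stub 3 (`stub_holeCost`, d = 3, `β_c`, l-uniform; open, size L; co-hardest — the decorrelation step).**
`c · Σ_{u ∈ B_l} fullMass₁(u)·fullMass₂(u) ≤ (Z^∅)² · crossMomentK`, i.e. (dividing by `Z₀₁Z₂₃(Z^∅)²`)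
`E[N_B] ≥ c · E[N_B⁺]`, where `N_B⁺ = #(X₁⁺ ∩ X₂⁺ ∩ B_l)` is the window count of the UN-DEPLETED crossed clusters
`Xᵢ⁺ = C(aᵢ; Kᵢ ∪ L'ᵢ)` with two further independent FULL soups (whose mean factorises EXACTLY by the independence
of `K₁` and `K₂` — the right-hand side is a sum of products).  Content: conditionally on `(K₁,K₂)`, replacing the
soup domain `G − V(K₂)` by `G` (filling the HOLE left by the other strand's cluster, a far set of dimension
`D_HT ≈ 1.73`) changes the attachment mass of `K₁` by at most a constant factor ON AVERAGE; this is where the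
anti-correlation "a fat `K₂` near `u` depletes `L₂` there" (triage r1-1 (2)) is paid for.  No monotonicity of loop-O(1)
connectivities in the domain exists (counter-example: a chord added to a cycle lowers `ℓ^∅[u ↔ v]` from 1/2 to 1/4),
so this is a d = 3 statement, not a graph lemma.  Why it might fail: the deleted cluster is a RELEVANT defect
(`D_HT − Δ_ε = +0.32`, the route's StrandShadow count): near `V(K₂)` the soup is at an effective free boundary; the
bet is that this costs a constant, not a power of `l`, because `u ∈ X₁ ∩ X₂` needs `K₂` NEAR `u` only at the last
scale. -/
theorem stub_holeCost :
    ∃ c : ℝ, 0 < c ∧ ∀ l : ℕ, 1 ≤ l → ∃ N₀ : ℕ, ∀ N : ℕ, N₀ ≤ N → ∀ a : Fin 4 → ↥(box 3 N),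
      (∀ i, ((a i : Site 3)) = (l : ℤ) • tetra i) →
      (let G := ((zdGraph 3).comap (Subtype.val : ↥(box 3 N) → Site 3));
       let t : ℝ := Real.tanh (criticalBeta 3);
       c * ∑ u ∈ window N l, fullMass G t (a 0) (a 1) u * fullMass G t (a 2) (a 3) u
         ≤ loopO1PartitionFunction G t ∅ ^ 2 * crossMomentK G t (a 0) (a 1) (a 2) (a 3) (window N l)) := by
  sorry

/-- **Stub 4′ (`stub_pairHoleFilling`, d = 3, `β_c`, l-uniform; OPEN, co-hardest — the decorrelation step of the second
moment).**  PAIR HOLE FILLING: the window-summed crossed DEPLETED pair connections are dominated by `C ×` the product of the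
UN-depleted `ℓ^{xy} ⊗ ℓ^∅` pair connections (verbatim the hypothesis of the landed `Theorems.stub_crossPairTreeReduction`, which
with the landed Aizenman–Duminil-Copin tree bound `Theorems.stub_crossPairTreeBound` gives `CrossPairTree`).  No domain
monotonicity of `ℓ^∅`-connectivities exists; this is where conditioning the soup on avoiding the other cluster is paid for. -/
theorem stub_pairHoleFilling : PairHoleFilling := by
  sorry

/-- **Stub 7 (`stub_etaBounds`, the named two-point input; OPEN standard conjecture).**  `∃ η, HasIsingEtaBounds 3 η ∧ 0 ≤ η ∧
η < 1/2`: two-sided `η`-regularity of the critical two-point function of `ℤ³` with `η < 1/2` (rigorously only the envelopes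
`c‖x‖^{-2} ≤ ⟨σ₀σ_x⟩_{β_c} ≤ C‖x‖^{-1}` are known; Duminil-Copin–Panis 2025 prove `η ≤ 1/2` conditionally on existence).  Turns
into `TreeFloor ∧ Bubble` by the landed reductions. -/
theorem stub_etaBounds : ∃ η : ℝ, HasIsingEtaBounds 3 η ∧ 0 ≤ η ∧ η < 1 / 2 := by
  sorry

/-! ## Consistency: each registered stub IS its name-keyed alias (definitionally), and the wiring -/

example : Registered.stub_crossInclusion := stub_crossInclusion
example : Registered.stub_crossFactorisation := stub_crossFactorisation
example : Registered.stub_soupAttach := stub_soupAttach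
example : Registered.stub_holeCost := stub_holeCost
example : Registered.stub_pairHoleFilling := stub_pairHoleFilling
example : Registered.stub_etaBounds := stub_etaBounds

/-- Wiring check: the registered stubs feed `IndependentStrandsJoin_of` as stated. -/
example : IndependentStrandsJoin :=
  IndependentStrandsJoin_of stub_soupAttach stub_holeCost stub_pairHoleFilling stub_etaBounds

/-- Checked against the landed negatives: the line's constant is `≤ 1` as it must be (`jointSum_le_mul`,
`Negative/LoadBearing`), and Stub 1 — the only graph-uniform stub — is an identity, so
`not_graphUniformStrandsJoin` (`Negative/GraphUniform`) does not bite. -/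
example {V : Type*} [Fintype V] [DecidableEq V] (G : SimpleGraph V) [DecidableRel G.Adj] {t : ℝ} (ht : 0 ≤ t)
    (a : Fin 4 → V) :
    jointSum G t a ≤ loopO1PartitionFunction G t {a 0, a 1} * loopO1PartitionFunction G t {a 2, a 3} := by
  refine (le_of_eq ?_).trans (IndependentStrandsJoinNegative.jointSum_le_mul G ht a)
  unfold jointSum
  exact Finset.sum_congr rfl fun F₁ _ => Finset.sum_congr rfl fun F₂ _ => by congr 1

end Summit.CriticalPhenomena.Ising3DConformalLimit.Cruxes.IndependentStrandsJoin.CrossFatteningDecoupling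

end
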